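import Mathlib
import Summits.Ventures.DiscreteObjects.Mahler.QuarticCensusRow
import Summits.Ventures.DiscreteObjects.Mahler.OddDegreeCensus
import Summits.Ventures.DiscreteObjects.Mahler.SubLehmerDegreeFour
import Summits.Ventures.DiscreteObjects.Mahler.MahlerMeasurePerron
import Summits.Ventures.DiscreteObjects.Mahler.MahlerMeasureUnit

/-!
# An irreducible sub-Lehmer polynomial has degree `≥ 6`; its measure is an irrational Perron unit
(venture `DiscreteObjects`, target L)

Cell `pub-namedobj`, seat `pub-namedobj-mahler` (gen 10). Framing: lottery ticket; floor = certified
bounds/negative ranges.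

Unconditional kernel facts about a hypothetical irreducible `P ∈ ℤ[X]` with `1 < M(P) < M(L) = 1.17628…`
(`SubLehmer P`), collecting gen-10 results (no use of the Mossinghoff–Rhin–Wu degree bound):
* `six_le_natDegree_of_subLehmer_irreducible` — `deg P ≥ 6` (degrees `≤ 3`: gen 8; degree `4`:
  `degreeCensus_four`; degree `5`: `degreeCensus_odd_of_not_three_dvd`);
* `irrational_intMahlerMeasure_of_lt_two` — any Mahler measure in `(1, 2)` is irrational (it is an
  algebraic integer, Prop. 1.9); in particular `M(P)` and Lehmer's number are irrational;
* `subLehmer_measure_arith` — `M(P)` is an algebraic integer, a unit (`M(P)⁻¹` is an algebraic integer)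
  and a Perron number (all other conjugates have modulus `< M(P)`).
-/

namespace Summit.Ventures.DiscreteObjects.Mahler

open Polynomial

/-- **An irreducible sub-Lehmer polynomial has degree at least `6`** (unconditionally). -/
theorem six_le_natDegree_of_subLehmer_irreducible {P : ℤ[X]} (hirr : Irreducible P) (hP : SubLehmer P) :
    6 ≤ P.natDegree := by
  have h4 := four_le_natDegree_of_subLehmer_irreducible hirr hP
  have hlt : intMahlerMeasure P < 13248 / 10000 :=
    lt_trans hP.2 (lt_trans lehmer_measure_upper_bound (by norm_num))
  by_contra hlt6
  push Not at hlt6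
  rcases (by omega : P.natDegree = 4 ∨ P.natDegree = 5) with hd | hd
  · obtain ⟨l, hl, -⟩ := degreeCensus_four P hd hirr hP.1 hlt
    simp at hl
  · obtain ⟨l, hl, -⟩ := degreeCensus_odd_of_not_three_dvd (n := 5) (by decide) (by decide) P hd hirr hP.1 hlt
    simp at hl

/-- **A Mahler measure in `(1, 2)` is irrational:** `M(P)` is an algebraic integer (Prop. 1.9), and a
rational algebraic integer is an integer. -/
theorem irrational_intMahlerMeasure_of_lt_two {P : ℤ[X]} (h1 : 1 < intMahlerMeasure P)
    (h2 : intMahlerMeasure P < 2) : Irrational (intMahlerMeasure P) := by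
  rintro ⟨q, hq⟩
  have hint : IsIntegral ℤ (intMahlerMeasure P) := isIntegral_intMahlerMeasure P
  rw [← hq] at hint h1 h2
  have hq' : IsIntegral ℤ q :=
    (isIntegral_algebraMap_iff (A := ℚ) (B := ℝ) (algebraMap ℚ ℝ).injective).mp hint
  obtain ⟨n, hn⟩ := IsIntegrallyClosed.isIntegral_iff.mp hq'
  have hqn : (q : ℝ) = (n : ℝ) := by rw [← hn]; simp
  rw [hqn] at h1 h2
  have h1' : (1 : ℤ) < n := by exact_mod_cast h1
  have h2' : n < (2 : ℤ) := by exact_mod_cast h2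
  omega

/-- Lehmer's number `M(L) = 1.17628…` is irrational. -/
theorem irrational_lehmer_measure : Irrational (intMahlerMeasure lehmerPoly) :=
  irrational_intMahlerMeasure_of_lt_two (lt_trans (by norm_num) lehmer_measure_enclosure.1)
    (lt_trans lehmer_measure_upper_bound (by norm_num))

/-- **Arithmetic nature of a sub-Lehmer measure.**  For an irreducible sub-Lehmer `P`: `M(P)` is an
algebraic integer, `M(P)⁻¹` is an algebraic integer (so `M(P)` is a unit), `M(P)` is irrational, and every
conjugate `γ ≠ M(P)` of `M(P)` over `ℚ` has `|γ| < M(P)` (Perron). -/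
theorem subLehmer_measure_arith {P : ℤ[X]} (hirr : Irreducible P) (hP : SubLehmer P) :
    IsIntegral ℤ (intMahlerMeasure P) ∧ IsIntegral ℤ (intMahlerMeasure P)⁻¹ ∧
      Irrational (intMahlerMeasure P) ∧
      ∀ γ : ℂ, IsConjRoot ℚ ((intMahlerMeasure P : ℝ) : ℂ) γ →
        γ = ((intMahlerMeasure P : ℝ) : ℂ) ∨ ‖γ‖ < intMahlerMeasure P := by
  obtain ⟨hrev, ⟨heven, hd2⟩, -⟩ := subLehmer_irreducible_constraints hirr hP
  have hlt2 : intMahlerMeasure P < 2 := lt_trans hP.2 (lt_trans lehmer_measure_upper_bound (by norm_num))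
  -- `P` is reciprocal, so `|lc| = |P(0)|`, and `|lc| ≤ M < 2` forces `lc = ±1`; normalise to monic
  have hlc : (|P.leadingCoeff| : ℝ) ≤ intMahlerMeasure P := abs_leadingCoeff_le_intMahlerMeasure P
  have hlc1 : P.leadingCoeff = 1 ∨ P.leadingCoeff = -1 := by
    have hne : P.leadingCoeff ≠ 0 := leadingCoeff_ne_zero.mpr hirr.ne_zero
    have hle : |P.leadingCoeff| ≤ 1 := by
      by_contra h
      push Not at h
      have : (2 : ℝ) ≤ (|P.leadingCoeff| : ℝ) := by
        have : (2 : ℤ) ≤ |P.leadingCoeff| := h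
        exact_mod_cast this
      linarith
    rcases abs_le.mp hle with ⟨h1', h2'⟩
    omega
  obtain ⟨hmonic, hpm, hMm, -, -⟩ := monic_normalisation hlc1
  have hc0 : P.coeff 0 = P.leadingCoeff := by rw [← coeff_zero_reverse, hrev]
  have hm0 : (C P.leadingCoeff * P).coeff 0 = 1 ∨ (C P.leadingCoeff * P).coeff 0 = -1 := by
    left
    rw [coeff_C_mul, hc0]
    rcases hlc1 with h | h <;> simp [h]
  have hunit := isIntegral_inv_intMahlerMeasure hmonic hm0
  rw [hMm] at hunit
  exact ⟨isIntegral_intMahlerMeasure P, hunit, irrational_intMahlerMeasure_of_lt_two hP.1 hlt2,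
    fun γ hγ => intMahlerMeasure_isPerron P hγ⟩

end Summit.Ventures.DiscreteObjects.Mahler
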